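import Mathlib
import Literature.MathematicalPhysics.QuantumFieldTheory.PottsGaugeWilsonLoopTopology
import HarnessLib

/-!
# The random-current expansion of Ising (`ℤ₂`) lattice gauge theory
# (Forsström–Viklund 2025, Theorem 1.1) — PROVED on the finite torus

Transcription, with proof, of the "current expansion" of Wilson-loop numerators of Ising lattice
gauge theory, a graphical representation by plaquette CURRENTS `n : {plaquettes} → ℤ_{≥0}`
(surfaces with multiplicity) whose sources are edges:

* M. P. Forsström, F. Viklund, *Current expansion and couplings for Ising lattice gauge theory*,
  arXiv:2502.19942 (v2, 2025) [ForsstromViklund2025currents]. Loci (arXiv v2, confirmed on the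
  arXiv HTML rendering): §1.1 (Wilson action `S(σ) = -Σ_{p ∈ C₂(B_N)} ρ(dσ(p))` summed over
  ORIENTED plaquettes, `ρ(g) = e^{πi g}`, `μ_{β,N} ∝ e^{-βS}`, `W_γ = ρ(σ(γ))`,
  `Z_{β,N}[γ] = Σ_σ W_γ(σ) e^{-βS(σ)}`); §1.2 eq. (1.1) (currents with source `γ`:
  `𝒞_γ = {n ∈ 𝒞 : γ(e) + Σ_{p ∈ supp ∂̂e} n(p) ≡ 0 mod 2 ∀e}`), eq. (1.2)
  (`w(n) = ∏_{p ∈ C₂(B_N)⁺} (2β)^{n(p)}/n(p)!`), **Theorem 1.1** (eq. (1.3)):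
  `Z_{β,N}[γ] = |Ω¹(B_N, ℤ₂)| Σ_{n ∈ 𝒞_γ} w(n)`.

## Scope (read this first)

Gauge group `ℤ₂` only. Nothing here bears on the Yang–Mills mass gap for compact simple Lie
groups or on `BalabanLadder.IR`; in the `ym` ladder only the conditional finite-`𝕋⁴` rung
`BalabanLadder.UV` is closed by any route. The file is typed for the `ym-ir` census of graphical
representations (random currents lead to "summation over surfaces rather than paths").

## Setting and readings (transcriber's)

* (R1) The source works on the box `B_N = [-N,N]^m ∩ ℤ^m` with free boundary conditions; the
  identity is local algebra valid on any finite cell complex and is typed here on the discrete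
  torus `𝕋^d_L` of `ConstructiveQFTWave0`/`PlaquetteRandomCluster` (edge cochains
  `θ : Site d L → Fin d → ZMod 2`, plaquette field `res (td₁ θ)`). `-- TODO(general form): boxes
  in ℤ^m with free boundary.`
* (R2) `ρ(dσ(p))` for the two orientations of a plaquette coincide (`ρ` is real), so
  `e^{-βS(σ)} = ∏_{p ∈ C₂⁺} e^{2β ρ(dσ(p))}`; we type the positively oriented plaquettes
  `Plaquette d L` and the action `isingAction θ = -2 Σ_p ρ((δθ)(p))`.
* (R3) A loop `γ` (a `1`-chain with `γ(e) ∈ {-1,0,1}` and `∂γ = 0`) enters `W_γ = ρ(σ(γ))` and the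
  parity condition (1.1) only modulo `2`; we type `γ : Site d L → Fin d → ZMod 2` and
  `W_γ(θ) = ρ(θ(γ)) = ρ(pairing θ γ)`. Since `(∂p)(e) = ±1 ≡ 1 mod 2` for `e ∈ ∂p`, the parity
  condition `γ(e) + Σ_{p ∋ e} n(p) ≡ 0 mod 2` reads `bd₂ (n mod 2) = γ` in `C₁(𝕋; ℤ₂)`
  (`IsSourceOf`, with `bd₂ = δᵀ` of `PottsGaugeEdwardsSokal`).
* (R4) `Σ_{n ∈ 𝒞_γ} w(n)` is an infinite series over `ℤ_{≥0}^{C₂⁺}`; we state Theorem 1.1 both as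
  `HasSum` and with `tsum`. The switching lemma (Lemma 1.2) and the couplings (Theorem 1.3) are
  NOT typed here.

## Contents (everything PROVED; no named fact)

* `spin` (`ρ`), `plaqSpin`, `isingAction`, `boltzmann`, `wilsonSign` (`W_γ`), `loopNumerator`
  (`Z_{β,N}[γ]`), `Current`, `IsSourceOf` (`n ∈ 𝒞_γ`), `currentWeight` (`w(n)`);
* `hasSum_prod_pow_div_factorial` — `Σ_{n ∈ ℤ_{≥0}^ι} ∏ᵢ aᵢ^{nᵢ}/nᵢ! = ∏ᵢ e^{aᵢ}` (multi-index
  exponential series; the analytic step);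
* `sum_wilsonSign_mul_prod_plaqSpin_pow` — the combinatorial step
  `Σ_θ ρ(θ(γ)) ∏_p ρ((δθ)(p))^{n(p)} = |Ω¹| 𝟙[bd₂ (n mod 2) = γ]` (character orthogonality);
* `hasSum_currentExpansion`, `loopNumerator_eq_tsum` — **Theorem 1.1**.
-/

open Finset

namespace Literature.MathematicalPhysics.QuantumFieldTheory

namespace IsingGaugeCurrents

open LatticeForm PlaquetteRC

variable {d L : ℕ} [NeZero L]

/-! ### `ℤ₂` lattice gauge theory in `±1` variables -/

/-- `ρ(g) = e^{πi g} ∈ {±1}` for `g ∈ ℤ₂` ("the natural representation of `ℤ₂`").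
[cite: ForsstromViklund2025currents, §1.1 (ρ)] -/
def spin (x : ZMod 2) : ℝ := if x = 0 then 1 else -1

/-- `ρ` is a character: `ρ(x + y) = ρ(x) ρ(y)`. [cite: ForsstromViklund2025currents, §1.1 (ρ)] -/
theorem spin_add (x y : ZMod 2) : spin (x + y) = spin x * spin y := by
  have hx1 : ∀ z : ZMod 2, z ≠ 0 → z = 1 := by decide
  have h11 : (1 : ZMod 2) + 1 = 0 := by decide
  unfold spin
  by_cases hx : x = 0
  · subst hx; simp
  · by_cases hy : y = 0
    · subst hy; simp [hx]
    · rw [hx1 x hx, hx1 y hy]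
      simp [h11]

/-- `ρ(0) = 1`. [cite: ForsstromViklund2025currents, §1.1 (ρ)] -/
@[simp] theorem spin_zero : spin 0 = 1 := by simp [spin]

/-- `ρ(k • x) = ρ(x)^k`. [cite: ForsstromViklund2025currents, §1.1 (ρ)] -/
theorem spin_nsmul (k : ℕ) (x : ZMod 2) : spin (k • x) = spin x ^ k := by
  induction k with
  | zero => simp
  | succ k ih => rw [succ_nsmul, spin_add, ih, pow_succ]

/-- The plaquette variable `ρ(dσ(p)) ∈ {±1}` of the edge cochain `θ` (reading R1).
[cite: ForsstromViklund2025currents, §1.1 (dσ(p), ρ(dσ(p)))] -/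
def plaqSpin (θ : Site d L → Fin d → ZMod 2) (p : Plaquette d L) : ℝ := spin (res (td₁ θ) p)

/-- The Wilson action `S(σ) = -Σ_{p ∈ C₂} ρ(dσ(p))` over ORIENTED plaquettes, i.e. `-2 Σ_{p ∈ C₂⁺}`
(reading R2). [cite: ForsstromViklund2025currents, §1.1 (S(σ))] -/
def isingAction (θ : Site d L → Fin d → ZMod 2) : ℝ := -2 * ∑ p : Plaquette d L, plaqSpin θ p

/-- The Boltzmann weight `e^{-βS(σ)}`. [cite: ForsstromViklund2025currents, §1.1 (μ_{β,N})] -/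
noncomputable def boltzmann (β : ℝ) (θ : Site d L → Fin d → ZMod 2) : ℝ := Real.exp (-β * isingAction θ)

/-- `e^{-βS(σ)} = ∏_{p ∈ C₂⁺} e^{2β ρ(dσ(p))}` (reading R2). [cite: ForsstromViklund2025currents, §1.1] -/
theorem boltzmann_eq_prod (β : ℝ) (θ : Site d L → Fin d → ZMod 2) :
    boltzmann β θ = ∏ p : Plaquette d L, Real.exp (2 * β * plaqSpin θ p) := by
  rw [boltzmann, isingAction, ← Real.exp_sum]
  congr 1
  rw [Finset.mul_sum, Finset.mul_sum]
  exact Finset.sum_congr rfl fun p _ => by ring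

/-- The Wilson loop variable `W_γ(σ) = ρ(σ(γ)) = ∏_{e ∈ γ} ρ(σ_e)` of a `ℤ₂` `1`-chain `γ`
(reading R3). [cite: ForsstromViklund2025currents, §1.1 (W_γ)] -/
def wilsonSign (γ θ : Site d L → Fin d → ZMod 2) : ℝ := spin (pairing θ γ)

/-- The Wilson-loop numerator `Z_{β,N}[γ] = Σ_σ W_γ(σ) e^{-βS(σ)}` (so that
`𝔼_{β,N}[W_γ] = Z_{β,N}[γ]/Z_{β,N}[0]`). [cite: ForsstromViklund2025currents, §1.1 (Z_{β,N}[γ])] -/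
noncomputable def loopNumerator (β : ℝ) (γ : Site d L → Fin d → ZMod 2) : ℝ :=
  ∑ θ : Site d L → Fin d → ZMod 2, wilsonSign γ θ * boltzmann β θ

/-! ### Currents -/

/-- A CURRENT: a non-negative integer multiplicity on every positively oriented plaquette
(`𝒞 = {n ∈ Ω²(B_N, ℤ) : n(p) ≥ 0}`). [cite: ForsstromViklund2025currents, §1.2 (𝒞)] -/
abbrev Current (d L : ℕ) : Type := Plaquette d L → ℕ

/-- `n ∈ 𝒞_γ`, "currents with source `γ`": the parity condition
`γ(e) + Σ_{p ∈ supp ∂̂e} n(p) ≡ 0 mod 2` for every edge `e`, i.e. `∂(n mod 2) = γ` in `C₁(𝕋; ℤ₂)`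
(reading R3; an `abbrev`, so that the equality of `ℤ₂`-chains is decidable). [cite: ForsstromViklund2025currents, §1.2 eq. (1.1)] -/
abbrev IsSourceOf (γ : Site d L → Fin d → ZMod 2) (n : Current d L) : Prop :=
  bd₂ (fun p => (n p : ZMod 2)) = γ

/-- The weight `w(n) = w_β(n) = ∏_{p ∈ C₂⁺} (2β)^{n(p)}/n(p)!` of a current.
[cite: ForsstromViklund2025currents, §1.2 eq. (1.2)] -/
noncomputable def currentWeight (β : ℝ) (n : Current d L) : ℝ :=
  ∏ p : Plaquette d L, (2 * β) ^ n p / (n p).factorial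

/-! ### The analytic step: the multi-index exponential series -/

/-- **Multi-index exponential series**: for a finite index type `ι` and reals `aᵢ`,
`Σ_{n : ι → ℕ} ∏ᵢ aᵢ^{nᵢ}/nᵢ! = ∏ᵢ e^{aᵢ}` (absolutely convergent; the expansion of
`∏_p e^{2βρ(dσ(p))}` used in the proof of Theorem 1.1). [cite: ForsstromViklund2025currents, Thm. 1.1 (proof)] -/
theorem hasSum_prod_pow_div_factorial (ι : Type) [Fintype ι] (a : ι → ℝ) :
    HasSum (fun n : ι → ℕ => ∏ i, a i ^ n i / ((n i).factorial : ℝ)) (∏ i, Real.exp (a i)) := by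
  revert a
  refine Fintype.induction_empty_option (P := fun (α : Type) [Fintype α] =>
    ∀ a : α → ℝ, HasSum (fun n : α → ℕ => ∏ i, a i ^ n i / ((n i).factorial : ℝ))
      (∏ i, Real.exp (a i))) ?_ ?_ ?_ ι
  · -- transport along an equivalence of index types
    intro α κ _ e h a
    letI : Fintype α := Fintype.ofEquiv κ e.symm
    have h' := h (fun i => a (e i))
    have hw : (∏ i : α, Real.exp (a (e i))) = ∏ j : κ, Real.exp (a j) :=
      Fintype.prod_equiv e (fun i => Real.exp (a (e i))) (fun j => Real.exp (a j)) (fun _ => rfl)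
    rw [hw] at h'
    have key : (fun m : κ → ℕ => ∏ j, a j ^ m j / ((m j).factorial : ℝ)) =
        (fun n : α → ℕ => ∏ i, a (e i) ^ n i / ((n i).factorial : ℝ)) ∘
          (e.symm.arrowCongr (Equiv.refl ℕ)) := by
      funext m
      simp only [Function.comp_apply, Equiv.arrowCongr_apply, Equiv.coe_refl, Equiv.symm_symm]
      exact (Fintype.prod_equiv e (fun i => a (e i) ^ (m ∘ e) i / (((m ∘ e) i).factorial : ℝ))
        (fun j => a j ^ m j / ((m j).factorial : ℝ)) (fun _ => rfl)).symm
    rw [key]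
    exact (Equiv.hasSum_iff _).mpr h'
  · -- empty index type: one multi-index, empty products
    intro a
    have hfun : (fun n : PEmpty.{1} → ℕ => ∏ i, a i ^ n i / ((n i).factorial : ℝ)) = fun _ => 1 := by
      funext n; simp
    rw [hfun]
    simp only [Finset.univ_eq_empty, Finset.prod_empty]
    have := hasSum_fintype (fun _ : PEmpty.{1} → ℕ => (1 : ℝ))
    simp only [Finset.univ_unique, Finset.sum_singleton] at this
    exact this
  · -- adjoin one index: Cauchy product of the one-variable series with the induction hypothesis
    intro α _ ih a
    set f : ℕ → ℝ := fun k => a none ^ k / (k.factorial : ℝ) with hfdef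
    set g : (α → ℕ) → ℝ := fun m => ∏ i, a (some i) ^ m i / ((m i).factorial : ℝ) with hgdef
    have hf : HasSum f (Real.exp (a none)) := by
      rw [hfdef, Real.exp_eq_exp_ℝ]
      exact NormedSpace.expSeries_div_hasSum_exp (a none)
    have hg : HasSum g (∏ i, Real.exp (a (some i))) := ih (fun i => a (some i))
    have hfn : Summable (fun k : ℕ => ‖f k‖) := by
      refine (NormedSpace.expSeries_div_summable (𝔸 := ℝ) ‖a none‖).congr fun k => ?_
      rw [hfdef, norm_div, norm_pow, Real.norm_natCast]
    have hgn : Summable (fun m : α → ℕ => ‖g m‖) := by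
      refine (ih (fun i => ‖a (some i)‖)).summable.congr fun m => ?_
      rw [hgdef, norm_prod]
      refine Finset.prod_congr rfl fun i _ => ?_
      rw [norm_div, norm_pow, Real.norm_natCast]
    have hfg : Summable (fun x : ℕ × (α → ℕ) => f x.1 * g x.2) :=
      summable_mul_of_summable_norm hfn hgn
    have hprod : HasSum (fun x : ℕ × (α → ℕ) => f x.1 * g x.2)
        (Real.exp (a none) * ∏ i, Real.exp (a (some i))) := HasSum.mul hf hg hfg
    rw [Fintype.prod_option]
    have key : (fun n : Option α → ℕ => ∏ o, a o ^ n o / ((n o).factorial : ℝ)) =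
        (fun x : ℕ × (α → ℕ) => f x.1 * g x.2) ∘
          (Equiv.piOptionEquivProd (β := fun _ : Option α => ℕ)) := by
      funext n
      rw [Function.comp_apply, Fintype.prod_option, hfdef, hgdef]
      rfl
    rw [key]
    exact (Equiv.hasSum_iff _).mpr hprod

/-! ### The combinatorial step: character sums over the gauge fields -/

/-- `ρ` of a finite sum is the product. [cite: ForsstromViklund2025currents, §1.1 (ρ)] -/
theorem spin_sum {ι : Type*} (s : Finset ι) (x : ι → ZMod 2) :
    spin (∑ i ∈ s, x i) = ∏ i ∈ s, spin (x i) := by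
  classical
  induction s using Finset.induction_on with
  | empty => simp
  | insert a s ha ih => rw [Finset.sum_insert ha, Finset.prod_insert ha, spin_add, ih]

/-- `θ ↦ ⟨θ, γ⟩` evaluated on the edge indicator: `⟨𝟙_e, γ⟩ = γ(e)`. [cite: ForsstromViklund2025currents, §2 (chains and cochains)] -/
theorem pairing_edgeInd_left {R : Type*} [CommRing R] (x : Site d L) (k : Fin d)
    (γ : Site d L → Fin d → R) : pairing (edgeInd (R := R) x k) γ = γ x k := by
  unfold pairing edgeInd
  rw [Finset.sum_eq_single x]
  · rw [Finset.sum_eq_single k]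
    · simp
    · intro l _ hl; simp [hl]
    · intro h; exact absurd (Finset.mem_univ k) h
  · intro y _ hy; exact Finset.sum_eq_zero fun l _ => by simp [hy]
  · intro h; exact absurd (Finset.mem_univ x) h

/-- `⟨θ, γ + γ'⟩ = ⟨θ, γ⟩ + ⟨θ, γ'⟩`. [cite: ForsstromViklund2025currents, §2] -/
theorem pairing_add_right {R : Type*} [CommRing R] (θ γ γ' : Site d L → Fin d → R) :
    pairing θ (γ + γ') = pairing θ γ + pairing θ γ' := by
  unfold pairing
  simp only [Pi.add_apply, mul_add, Finset.sum_add_distrib]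

/-- **Orthogonality of `ℤ₂` characters on the gauge fields**: `Σ_σ ρ(σ(c)) = |Ω¹|` if the
`1`-chain `c` vanishes (mod 2) and `0` otherwise. [cite: ForsstromViklund2025currents, Thm. 1.1 (proof)] -/
theorem sum_spin_pairing (c : Site d L → Fin d → ZMod 2) :
    ∑ θ : Site d L → Fin d → ZMod 2, spin (pairing θ c) =
      if c = 0 then (Fintype.card (Site d L → Fin d → ZMod 2) : ℝ) else 0 := by
  classical
  split_ifs with hc
  · subst hc
    have : ∀ θ : Site d L → Fin d → ZMod 2, pairing θ 0 = 0 := fun θ => by simp [pairing]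
    simp [this]
  · obtain ⟨x, k, hxk⟩ : ∃ x k, c x k ≠ 0 := by
      by_contra h
      push Not at h
      exact hc (funext fun x => funext fun k => h x k)
    have hone : c x k = 1 := by
      have : ∀ z : ZMod 2, z ≠ 0 → z = 1 := by decide
      exact this _ hxk
    set S := ∑ θ : Site d L → Fin d → ZMod 2, spin (pairing θ c) with hS
    have hshift : S = spin 1 * S := by
      rw [hS, Finset.mul_sum, ← Equiv.sum_comp (Equiv.addRight (edgeInd (R := ZMod 2) x k))]
      refine Finset.sum_congr rfl fun θ _ => ?_
      rw [Equiv.coe_addRight, pairing_add_left, pairing_edgeInd_left, hone, spin_add, mul_comm]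
    have h1 : spin 1 = -1 := by simp [spin]
    rw [h1] at hshift
    linarith

/-- **The combinatorial heart of Theorem 1.1**: for a current `n` and a `ℤ₂` `1`-chain `γ`,
`Σ_σ ρ(σ(γ)) ∏_p ρ(dσ(p))^{n(p)} = |Ω¹(𝕋, ℤ₂)| · 𝟙[n ∈ 𝒞_γ]` — summing the gauge field
against `ρ(σ(γ) + Σ_p n(p) dσ(p)) = ρ(σ(γ + ∂n))` enforces the parity condition (1.1).
[cite: ForsstromViklund2025currents, Thm. 1.1 (proof)] -/
theorem sum_wilsonSign_mul_prod_plaqSpin_pow (γ : Site d L → Fin d → ZMod 2) (n : Current d L) :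
    ∑ θ : Site d L → Fin d → ZMod 2, wilsonSign γ θ * ∏ p, plaqSpin θ p ^ n p =
      if IsSourceOf γ n then (Fintype.card (Site d L → Fin d → ZMod 2) : ℝ) else 0 := by
  classical
  set nbar : Plaquette d L → ZMod 2 := fun p => (n p : ZMod 2) with hnbar
  have hterm : ∀ θ : Site d L → Fin d → ZMod 2,
      wilsonSign γ θ * ∏ p, plaqSpin θ p ^ n p = spin (pairing θ (γ + bd₂ nbar)) := by
    intro θ
    have h1 : ∏ p, plaqSpin θ p ^ n p = spin (pairing θ (bd₂ nbar)) := by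
      rw [pairing_bd₂]
      unfold pairing₂ plaqSpin
      rw [spin_sum]
      refine Finset.prod_congr rfl fun p _ => ?_
      rw [← spin_nsmul, nsmul_eq_mul, hnbar, mul_comm]
    rw [wilsonSign, h1, ← spin_add, ← pairing_add_right]
  simp_rw [hterm]
  rw [sum_spin_pairing]
  have hneg : ∀ u : Site d L → Fin d → ZMod 2, -u = u := fun u => by
    funext x k
    have : ∀ z : ZMod 2, -z = z := by decide
    exact this _
  have hiff : γ + bd₂ nbar = 0 ↔ IsSourceOf γ n := by
    unfold IsSourceOf
    rw [← hnbar]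
    constructor
    · intro h
      have := congrArg (fun u => u - γ) h
      simp only [add_sub_cancel_left, zero_sub] at this
      rw [this, hneg]
    · intro h
      rw [h]
      funext x k
      have h2 : ∀ z : ZMod 2, z + z = 0 := by decide
      exact h2 _
  by_cases h : IsSourceOf γ n
  · rw [if_pos h, if_pos (hiff.mpr h)]
  · rw [if_neg h, if_neg (fun h' => h (hiff.mp h'))]

/-! ### Theorem 1.1: the current expansion -/

/-- **Theorem 1.1 (Forsström–Viklund, current expansion), PROVED on the finite torus.** For every
`β` and every `ℤ₂` `1`-chain `γ`: `Z_{β}[γ] = |Ω¹(𝕋; ℤ₂)| · Σ_{n ∈ 𝒞_γ} w(n)`, i.e. the family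
`n ↦ 𝟙[n ∈ 𝒞_γ] w(n)` on `ℤ_{≥0}^{C₂⁺}` is summable with sum `Z_β[γ]/|Ω¹|` (reading R4). Proof as
printed: expand `e^{2βρ(dσ(p))} = Σ_k (2β)^k ρ(dσ(p))^k / k!` on every plaquette and sum out the
gauge field, which enforces the parity condition (1.1). [cite: ForsstromViklund2025currents, Thm. 1.1 eq. (1.3)] -/
theorem hasSum_currentExpansion (β : ℝ) (γ : Site d L → Fin d → ZMod 2) :
    HasSum (fun n : Current d L => if IsSourceOf γ n then currentWeight β n else 0)
      (loopNumerator β γ / Fintype.card (Site d L → Fin d → ZMod 2)) := by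
  classical
  have hcard : (Fintype.card (Site d L → Fin d → ZMod 2) : ℝ) ≠ 0 := by
    exact_mod_cast Fintype.card_ne_zero
  -- per gauge field: the multi-index expansion of the Boltzmann weight
  have hθ : ∀ θ : Site d L → Fin d → ZMod 2,
      HasSum (fun n : Current d L => wilsonSign γ θ * (currentWeight β n * ∏ p, plaqSpin θ p ^ n p))
        (wilsonSign γ θ * boltzmann β θ) := by
    intro θ
    refine HasSum.mul_left _ ?_
    rw [boltzmann_eq_prod]
    have h := hasSum_prod_pow_div_factorial (Plaquette d L) (fun p => 2 * β * plaqSpin θ p)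
    have hfn : (fun n : Current d L => currentWeight β n * ∏ p, plaqSpin θ p ^ n p) =
        fun n : Current d L => ∏ p, (2 * β * plaqSpin θ p) ^ n p / ((n p).factorial : ℝ) := by
      funext n
      rw [currentWeight, ← Finset.prod_mul_distrib]
      refine Finset.prod_congr rfl fun p _ => ?_
      rw [mul_pow]
      ring
    rw [hfn]
    exact h
  -- sum over the (finitely many) gauge fields and use the character sum
  have hsum := hasSum_sum (s := (Finset.univ : Finset (Site d L → Fin d → ZMod 2)))
    (fun θ _ => hθ θ)
  have hfun : (fun n : Current d L => ∑ θ : Site d L → Fin d → ZMod 2,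
      wilsonSign γ θ * (currentWeight β n * ∏ p, plaqSpin θ p ^ n p)) =
      fun n => currentWeight β n *
        (if IsSourceOf γ n then (Fintype.card (Site d L → Fin d → ZMod 2) : ℝ) else 0) := by
    funext n
    rw [← sum_wilsonSign_mul_prod_plaqSpin_pow γ n, Finset.mul_sum]
    refine Finset.sum_congr rfl fun θ _ => ?_
    ring
  rw [hfun] at hsum
  have hdiv := hsum.div_const (Fintype.card (Site d L → Fin d → ZMod 2) : ℝ)
  have hfun2 : (fun n : Current d L => (if IsSourceOf γ n then currentWeight β n else 0)) =
      fun n => currentWeight β n *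
        (if IsSourceOf γ n then (Fintype.card (Site d L → Fin d → ZMod 2) : ℝ) else 0) /
          (Fintype.card (Site d L → Fin d → ZMod 2) : ℝ) := by
    funext n
    split_ifs
    · field_simp
    · simp
  rw [hfun2]
  unfold loopNumerator
  exact hdiv

/-- **Theorem 1.1, `tsum` form**: `Z_β[γ] = |Ω¹(𝕋; ℤ₂)| · Σ'_{n ∈ 𝒞_γ} w(n)`.
[cite: ForsstromViklund2025currents, Thm. 1.1 eq. (1.3)] -/
theorem loopNumerator_eq_tsum (β : ℝ) (γ : Site d L → Fin d → ZMod 2) :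
    loopNumerator β γ = Fintype.card (Site d L → Fin d → ZMod 2) *
      ∑' n : Current d L, (if IsSourceOf γ n then currentWeight β n else 0) := by
  have hcard : (Fintype.card (Site d L → Fin d → ZMod 2) : ℝ) ≠ 0 := by
    exact_mod_cast Fintype.card_ne_zero
  rw [(hasSum_currentExpansion β γ).tsum_eq]
  field_simp

end IsingGaugeCurrents

end Literature.MathematicalPhysics.QuantumFieldTheory
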